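import Summits.RiemannHypothesis.RiemannHypothesis.Theses.HardyZLehmerSplit
import Literature.NumberTheory.LFunctions.HardyZExtremaCriterionProofs
import Literature.NumberTheory.LFunctions.ZetaArgBacklundExplicit
import Literature.NumberTheory.LFunctions.HardyZSignParity
import Literature.NumberTheory.LFunctions.TuringMethod

/-!
# BC5 rung for `SigmaL` (route `HardyZLehmerSplit`, item stmt-RiemannHypothesis-24253) —
# a LOCAL, RH-free Ivić theorem and the certified-window instance of Σ_L above the
# Platt–Trudgian height

Tribunal seat `rh-trib-w-sigmaL-1` (bc5-witness planner). NOTHING HERE PROVES OR ASSUMES THE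
RIEMANN HYPOTHESIS; nothing here bears on the truth of RH.

`SigmaL` (crux, rank 3) says: for every `t > 3·10¹²`, a local minimum of Hardy's `Z` at `t` has
`Z(t) ≤ 0` and a local maximum has `Z(t) ≥ 0` (no "Lehmer violation"). In print only the direction
RH ⟹ Σ_L is known (Ivić 2003 §2 Prop. 1, tree `Ivic2003_prop1_holds`, with an INEFFECTIVE `t₀`).

This file makes Ivić's argument LOCAL and EFFECTIVE, RH-free:

* `localIvic` — if every zero of `ζ` with ordinate in `(A − ½, B + ½)` lies on the critical line
  and every `t ∈ (A, B)` has a critical zero in `(t, t + C₀]`, with `A > 4C₀²`, then `Z'/Z` is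
  strictly decreasing on every zero-free subinterval of `(A, B)` (the zeros OUTSIDE the padded
  window may be anywhere in the strip: an off-line zero `β + iγ` contributes the term
  `(t−γ)/((β−½)² + (t−γ)²)` to `Z'/Z`, which is decreasing in `t` as soon as `|t − γ| ≥ ½ > |β − ½|`);
* `noViolation_of_strictAnti` — hence no Lehmer violation on `(A, B)` (Ivić's two-critical-points
  contradiction, localised);
* `zetaZeroCount_lt_add_eight` — RH-free, from the tree's explicit Riemann–von Mangoldt bound
  `|N(T) − M(T)| ≤ 0.3083 log T + 4.128` (`abs_zetaZeroCount_sub_main_le_explicit`): for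
  `3·10¹² ≤ t ≤ 3.9·10¹² − 8` there is a zero with ordinate in `(t, t + 8]`;
* `noViolationOn_of_onLine` — Σ_L on `(A, B)` follows from "zeros with ordinate in
  `(A − ½, B + 8]` are on the line" alone, for `3·10¹² ≤ A`, `B + 8 ≤ 3.9·10¹²`;
* `noViolationOn_of_RH` + `sigmaL_iff_forall_noViolationOn` (§7) — the crux is RH-implied
  EFFECTIVELY (`Summit.RiemannHypothesis → SigmaL`, Ivić's `t₀` made `≤ 3·10¹²`; direction S ⟹ C
  only, recorded for the tribunal; nothing about the truth of RH);
* `onLine_of_located_zeros`, `onLineBetween_of_window_certificate` (§8) — the windowed Brent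
  criterion, RH-free: `m` certified strict sign changes of `Z` on a grid in `[T₁, T₂]` and the count
  inequality `N(T₂) ≤ N(T₁) + m` (Turing's method at both ends) ⟹ every zero with ordinate in
  `(T₁, T₂]` is on the line — so the stub below is EXACTLY "supply the certified data".

Two instances:

* `SigmaL_rung_belowPT` (PROVED from the cite fact `platt_trudgian_numerical_rh` = the route's
  `HeightPT`): Σ_L holds on `(3·10¹², 3 000 175 332 792)`. This lies INSIDE RH's verified range, so
  it is NOT the T3 witness; it shows the reduction is real and effective (Ivić's `t₀` is no issue at
  this height: `4·8² + 1 = 257`).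
* `SigmaL_rung_W0` — **the BC5 rung**: Σ_L on the window `W0 = (H₀ + 20, H₀ + 30)`,
  `H₀ = 3 000 175 332 800` (ABOVE the Platt–Trudgian height, where RH is NOT known), PROVED from the
  single computational stub `stub_onLine_W0` = "every zero of `ζ` with ordinate in
  `(H₀ + 19, H₀ + 40)` has real part ½" — a FINITE CERTIFIED COMPUTATION for the tree's
  Riemann–Siegel interval evaluator (`RSEval.hardyZBoxS/X`, main sum `N = ⌊√(t/2π)⌋ = 691 00x`
  terms, no named-fact hypothesis) + Turing's method at both ends (`TuringMethodWindow`): locate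
  the ≈ 90 sign changes of `Z` on `(H₀+19, H₀+40)` and prove the count exact. PLAN-ONLY here
  (≈ 300–400 RS evaluations at `t ≈ 3.0002·10¹²`, est. 10–30 CPU-h of `native_decide`, a batched
  kit job split over ~60 files; not run by this seat). Honest label (J verdict): the rung is
  dominated by LOCAL Turing verification of RH on the padded window — Σ_L|W0 is implied by
  RH|(H₀+19, H₀+40) via `noViolationOn_of_onLine`; it is a decidable instance of Σ_L outside S's
  known regime, exercising the route's lever ((Z'/Z)' < 0 ⟹ the Laguerre sign pattern at critical
  points), and refutable by the same computation (a certified wrong-sign extremum there would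
  refute Σ_L and RH together).

References: Ivić 2003 §2 Prop. 1 (arXiv:math/0311162) [Ivic2003]; Edwards 1974 §8.3 [Edwards1974];
Platt–Trudgian 2021 Thm 1 [PlattTrudgian2021]; Trudgian 2014 (explicit `S(T)`) [Trudgian2014];
Brent 1979 Thm 3.2 (Turing's method) [Brent1979]; Gabcke 1979 Satz 3.2.2 [Gabcke1979].
-/

noncomputable section

open Complex Filter Set
open scoped Real Topology ComplexConjugate
open Literature.NumberTheory.LFunctions

namespace Summit.RiemannHypothesis.RiemannHypothesis.Cruxes.SigmaL.Rung

/-! ## §0. Statement shapes -/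

/-- Σ_L restricted to the open height window `(A, B)`: no positive local minimum and no negative
local maximum of Hardy's `Z` there. -/
def NoViolationOn (A B : ℝ) : Prop :=
  ∀ t : ℝ, A < t → t < B →
    (IsLocalMin hardyZ t → hardyZ t ≤ 0) ∧ (IsLocalMax hardyZ t → 0 ≤ hardyZ t)

/-- "RH in the height window `(A', B')`": every zero of `ζ` with ordinate in `(A', B')` has real
part `½` (for `A' ≥ 0` only nontrivial zeros have such ordinates). The shape of
`RiemannHypothesisUpTo`, windowed. -/
def OnLineBetween (A' B' : ℝ) : Prop :=
  ∀ s : ℂ, riemannZeta s = 0 → A' < s.im → s.im < B' → s.re = 1 / 2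

/-- Every `t ∈ (A, B)` has a critical zero `½ + iγ` of `ζ` with `t < γ ≤ t + C₀`. -/
def CriticalZeroWithin (A B C₀ : ℝ) : Prop :=
  ∀ t : ℝ, A < t → t < B → ∃ γ : ℝ, t < γ ∧ γ ≤ t + C₀ ∧ riemannZeta (1 / 2 + (γ : ℂ) * I) = 0

/-- The rung window is a special case of the crux: `SigmaL → NoViolationOn A B` for `A ≥ 3·10¹²`. -/
theorem noViolationOn_of_SigmaL {A B : ℝ} (hA : 3000000000000 ≤ A)
    (h : Summit.RiemannHypothesis.RiemannHypothesis.Theses.HardyZLehmerSplit.SigmaL) :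
    NoViolationOn A B :=
  fun t hAt _ ↦ h t (lt_of_le_of_lt hA hAt)

/-! ## §1. Algebra of one zero term `φ_d(u) = u/(d + u²)` (`d = (β − ½)²`, `u = t ∓ γ`) -/

/-- `−Im (1/z) = Im z/(Re z² + Im z²)` (both sides `0` at `z = 0`). [folklore] -/
theorem neg_im_one_div (z : ℂ) : -(1 / z).im = z.im / (z.re ^ 2 + z.im ^ 2) := by
  rw [one_div, Complex.inv_im, neg_div, neg_neg, Complex.normSq_apply]
  congr 1
  ring

/-- `φ_d(u₁) − φ_d(u₂) = (u₂−u₁)(u₁u₂−d)/((d+u₁²)(d+u₂²))`. [folklore] -/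
theorem phi_sub_eq {d u₁ u₂ : ℝ} (h₁ : d + u₁ ^ 2 ≠ 0) (h₂ : d + u₂ ^ 2 ≠ 0) :
    u₁ / (d + u₁ ^ 2) - u₂ / (d + u₂ ^ 2) =
      (u₂ - u₁) * (u₁ * u₂ - d) / ((d + u₁ ^ 2) * (d + u₂ ^ 2)) := by
  field_simp
  ring

/-- `φ_d` decreases from `u₁` to `u₂` (`u₁ ≤ u₂`) as soon as `u₁u₂ > d ≥ 0`: the term of a zero
`β + iγ` in `Z'/Z` decreases on `[t₁, t₂]` when `(t₁−γ)(t₂−γ) > (β−½)²`. [folklore] -/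
theorem phi_sub_nonneg {d u₁ u₂ : ℝ} (hd : 0 ≤ d) (hprod : d < u₁ * u₂) (h12 : u₁ ≤ u₂) :
    0 ≤ u₁ / (d + u₁ ^ 2) - u₂ / (d + u₂ ^ 2) := by
  have hu₁ : u₁ ≠ 0 := by rintro rfl; simp at hprod; linarith
  have hu₂ : u₂ ≠ 0 := by rintro rfl; simp at hprod; linarith
  have hsq₁ : 0 < u₁ ^ 2 := by positivity
  have hsq₂ : 0 < u₂ ^ 2 := by positivity
  have h₁ : 0 < d + u₁ ^ 2 := by linarith
  have h₂ : 0 < d + u₂ ^ 2 := by linarith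
  rw [phi_sub_eq h₁.ne' h₂.ne']
  exact div_nonneg (mul_nonneg (by linarith) (by linarith)) (by positivity)

/-- On the line (`d = 0`) the term is `1/u`. [folklore] -/
theorem phi_zero (u : ℝ) : u / ((1 / 2 - 1 / 2 : ℝ) ^ 2 + u ^ 2) = 1 / u := by
  have e : (1 / 2 - 1 / 2 : ℝ) ^ 2 + u ^ 2 = u * u := by ring
  rw [e]
  rcases eq_or_ne u 0 with rfl | hu
  · simp
  · rw [← div_div, div_self hu]

/-- `1/(t₁−γ) − 1/(t₂−γ) = (t₂−t₁)/((t₁−γ)(t₂−γ))` when `(t₁−γ)(t₂−γ) ≠ 0`. [folklore] -/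
theorem one_div_sub_one_div_eq {t₁ t₂ γ : ℝ} (h : (t₁ - γ) * (t₂ - γ) ≠ 0) :
    1 / (t₁ - γ) - 1 / (t₂ - γ) = (t₂ - t₁) / ((t₁ - γ) * (t₂ - γ)) := by
  have h1 : t₁ - γ ≠ 0 := fun e ↦ h (by rw [e, zero_mul])
  have h2 : t₂ - γ ≠ 0 := fun e ↦ h (by rw [e, mul_zero])
  field_simp
  ring

/-- For `t₁ ≤ t₂` on the same side of `γ`: `1/(t₁−γ) − 1/(t₂−γ) ≥ 0`. [folklore] -/
theorem one_div_sub_one_div_nonneg {t₁ t₂ γ : ℝ} (h : 0 < (t₁ - γ) * (t₂ - γ))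
    (h12 : t₁ ≤ t₂) : 0 ≤ 1 / (t₁ - γ) - 1 / (t₂ - γ) := by
  rw [one_div_sub_one_div_eq h.ne']
  exact div_nonneg (by linarith) h.le

/-- If `(t₁ − γ)(t₂ − γ) ≤ 0` and `t₁ ≤ t₂` then `γ ∈ [t₁, t₂]`. [folklore] -/
theorem mem_Icc_of_mul_nonpos {t₁ t₂ γ : ℝ} (h : (t₁ - γ) * (t₂ - γ) ≤ 0) (h12 : t₁ ≤ t₂) :
    γ ∈ Icc t₁ t₂ := by
  rcases mul_nonpos_iff.1 h with ⟨h1, h2⟩ | ⟨h1, h2⟩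
  · constructor <;> nlinarith
  · constructor <;> linarith

/-! ## §2. The zero sum for `Z'/Z`, RH-free: `−Im ξ'/ξ(½+it) = Σₙ −Im[1/(s−ρₙ) + 1/(s−(1−ρₙ))]` -/

variable {b : ℕ → ℂ}

/-- The real pair term `−Im [1/(s−ρₙ) + 1/(s−(1−ρₙ))]` at `s = ½ + it` (padding indices read `0`). -/
def pairTerm (b : ℕ → ℂ) (n : ℕ) (t : ℝ) : ℝ :=
  -((if b n = 0 then (0 : ℂ) else
      1 / ((1 / 2 : ℂ) + (t : ℂ) * I - IsHadamardSeq.xiZero b n) +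
        1 / ((1 / 2 : ℂ) + (t : ℂ) * I - (1 - IsHadamardSeq.xiZero b n))).im)

/-- **Ivić (2.1) on the critical line, RH-FREE.** For a Hadamard sequence `b` of `ξ` and
`s = ½ + it` with `ξ(s) ≠ 0`, `Σₙ pairTerm b n t = −Im ξ'/ξ(s)` (the tree's grouped Hadamard
series `IsHadamardSeq.logDeriv_riemannXi_eq_tsum_pairs`, imaginary parts). -/
theorem hasSum_pairTerm (h : IsHadamardSeq 0 b) {t : ℝ}
    (hξ : riemannXi ((1 / 2 : ℂ) + (t : ℂ) * I) ≠ 0) :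
    HasSum (fun n ↦ pairTerm b n t) (-(logDeriv riemannXi ((1 / 2 : ℂ) + (t : ℂ) * I)).im) := by
  have hS := (Complex.hasSum_im (h.summable_pairs hξ).hasSum).neg
  rw [← h.logDeriv_riemannXi_eq_tsum_pairs hξ] at hS
  exact hS.congr_fun fun n ↦ rfl

/-- The pair term written out: with `ρₙ = β + iγ`,
`pairTerm = (t−γ)/((½−β)² + (t−γ)²) + (t+γ)/((½−β)² + (t+γ)²)`. [folklore] -/
theorem pairTerm_eq {n : ℕ} (hn : b n ≠ 0) (t : ℝ) :
    pairTerm b n t =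
      (t - (IsHadamardSeq.xiZero b n).im) /
          ((1 / 2 - (IsHadamardSeq.xiZero b n).re) ^ 2 + (t - (IsHadamardSeq.xiZero b n).im) ^ 2) +
        (t + (IsHadamardSeq.xiZero b n).im) /
          ((1 / 2 - (IsHadamardSeq.xiZero b n).re) ^ 2 + (t + (IsHadamardSeq.xiZero b n).im) ^ 2) := by
  unfold pairTerm
  rw [if_neg hn, Complex.add_im, neg_add, neg_im_one_div, neg_im_one_div]
  have hre1 : ((1 / 2 : ℂ) + (t : ℂ) * I - IsHadamardSeq.xiZero b n).re =
      1 / 2 - (IsHadamardSeq.xiZero b n).re := by simp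
  have him1 : ((1 / 2 : ℂ) + (t : ℂ) * I - IsHadamardSeq.xiZero b n).im =
      t - (IsHadamardSeq.xiZero b n).im := by simp
  have hre2 : ((1 / 2 : ℂ) + (t : ℂ) * I - (1 - IsHadamardSeq.xiZero b n)).re =
      -(1 / 2 - (IsHadamardSeq.xiZero b n).re) := by simp; ring
  have him2 : ((1 / 2 : ℂ) + (t : ℂ) * I - (1 - IsHadamardSeq.xiZero b n)).im =
      t + (IsHadamardSeq.xiZero b n).im := by simp
  rw [hre1, him1, hre2, him2, neg_sq]

/-- **Every pair term decreases across `[t₁, t₂]`** when `ζ(½+iu) ≠ 0` on `[t₁, t₂]` and the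
zeros with ordinate in `(A', B') ⊇ (t₁ − ½, t₂ + ½)` are on the line: an on-line zero has its
poles `±γ` outside `[t₁, t₂]`; an off-line zero `β ± iγ` has `|γ|` at distance `≥ ½ > |β − ½|` from
`[t₁, t₂]`, so `(t₁∓γ)(t₂∓γ) ≥ ¼ > (β−½)²`. RH-free. -/
theorem pairTerm_sub_nonneg (h : IsHadamardSeq 0 b) (n : ℕ) {t₁ t₂ A' B' : ℝ} (hlt : t₁ < t₂)
    (hZ : ∀ u ∈ Icc t₁ t₂, riemannZeta (1 / 2 + (u : ℂ) * I) ≠ 0)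
    (hA' : A' ≤ t₁ - 1 / 2) (hB' : t₂ + 1 / 2 ≤ B') (hline : OnLineBetween A' B') :
    0 ≤ pairTerm b n t₁ - pairTerm b n t₂ := by
  by_cases hn : b n = 0
  · simp [pairTerm, hn]
  obtain ⟨hζ, h0, h1⟩ := h.riemannZeta_xiZero hn
  rw [pairTerm_eq hn, pairTerm_eq hn]
  set ρ : ℂ := IsHadamardSeq.xiZero b n with hρdef
  set β : ℝ := ρ.re with hβdef
  set γ : ℝ := ρ.im with hγdef
  have hd0 : 0 ≤ (1 / 2 - β) ^ 2 := sq_nonneg _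
  have hd4 : (1 / 2 - β) ^ 2 < 1 / 4 := by nlinarith
  have hρeq : ρ = (β : ℂ) + (γ : ℂ) * I := by
    apply Complex.ext <;> simp [hβdef, hγdef]
  -- the conjugate zero `β − iγ`
  have hζc : riemannZeta ((β : ℂ) + ((-γ : ℝ) : ℂ) * I) = 0 := by
    have e : (starRingEnd ℂ) ρ = (β : ℂ) + ((-γ : ℝ) : ℂ) * I := by
      apply Complex.ext <;> simp [hβdef, hγdef]
    rw [← e, riemannZeta_conj, hζ, map_zero]
  -- first summand: `(½−β)² < (t₁ − γ)(t₂ − γ)`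
  have h1st : (1 / 2 - β) ^ 2 < (t₁ - γ) * (t₂ - γ) := by
    by_cases hβ : β = 1 / 2
    · have hd : (1 / 2 - β) ^ 2 = 0 := by rw [hβ]; norm_num
      rw [hd]
      by_contra hle
      push Not at hle
      obtain ⟨hl, hr⟩ := mem_Icc_of_mul_nonpos hle hlt.le
      refine hZ γ ⟨hl, hr⟩ ?_
      have e : (1 / 2 : ℂ) + (γ : ℂ) * I = ρ := by
        rw [hρeq, hβ]; push_cast; ring
      rw [e]; exact hζ
    · have hγout : γ ≤ A' ∨ B' ≤ γ := by
        by_contra hin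
        push Not at hin
        exact hβ (hline ρ hζ hin.1 hin.2)
      rcases hγout with hγA | hγB
      · have a1 : 1 / 2 ≤ t₁ - γ := by linarith
        have a2 : 1 / 2 ≤ t₂ - γ := by linarith
        have := mul_le_mul a1 a2 (by norm_num) (by linarith)
        linarith
      · have a1 : 1 / 2 ≤ γ - t₂ := by linarith
        have a2 : 1 / 2 ≤ γ - t₁ := by linarith
        have := mul_le_mul a2 a1 (by norm_num) (by linarith)
        have e : (t₁ - γ) * (t₂ - γ) = (γ - t₁) * (γ - t₂) := by ring
        linarith
  -- second summand: `(½−β)² < (t₁ + γ)(t₂ + γ)` (the pole `−γ` of the partner / conjugate)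
  have h2nd : (1 / 2 - β) ^ 2 < (t₁ + γ) * (t₂ + γ) := by
    by_cases hβ : β = 1 / 2
    · have hd : (1 / 2 - β) ^ 2 = 0 := by rw [hβ]; norm_num
      rw [hd]
      by_contra hle
      push Not at hle
      have hle' : (t₁ - -γ) * (t₂ - -γ) ≤ 0 := by
        have e : (t₁ - -γ) * (t₂ - -γ) = (t₁ + γ) * (t₂ + γ) := by ring
        rw [e]; exact hle
      obtain ⟨hl, hr⟩ := mem_Icc_of_mul_nonpos hle' hlt.le
      refine hZ (-γ) ⟨hl, hr⟩ ?_
      have e : (1 / 2 : ℂ) + ((-γ : ℝ) : ℂ) * I = (β : ℂ) + ((-γ : ℝ) : ℂ) * I := by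
        rw [hβ]; push_cast; ring
      rw [e]; exact hζc
    · have hγout : -γ ≤ A' ∨ B' ≤ -γ := by
        by_contra hin
        push Not at hin
        have hre : ((β : ℂ) + ((-γ : ℝ) : ℂ) * I).re = 1 / 2 :=
          hline _ hζc (by simpa using hin.1) (by simpa using hin.2)
        simp at hre
        exact hβ (by rw [hre]; norm_num)
      rcases hγout with hγA | hγB
      · have a1 : 1 / 2 ≤ t₁ + γ := by linarith
        have a2 : 1 / 2 ≤ t₂ + γ := by linarith
        have := mul_le_mul a1 a2 (by norm_num) (by linarith)
        linarith
      · have a1 : 1 / 2 ≤ -γ - t₂ := by linarith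
        have a2 : 1 / 2 ≤ -γ - t₁ := by linarith
        have := mul_le_mul a2 a1 (by norm_num) (by linarith)
        have e : (t₁ + γ) * (t₂ + γ) = (-γ - t₁) * (-γ - t₂) := by ring
        linarith
  have e1 := phi_sub_nonneg hd0 h1st (by linarith : t₁ - γ ≤ t₂ - γ)
  have e2 := phi_sub_nonneg hd0 h2nd (by linarith : t₁ + γ ≤ t₂ + γ)
  linarith

/-- **The zero sum drops by at least `(t₂−t₁)/C₀²` across a zero-free `[t₁, t₂]`** when a
critical zero `γ` lies in `(t₁, t₁ + C₀]` (RH-free, local hypotheses as in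
`pairTerm_sub_nonneg`): every term decreases and the term of `γ` alone loses
`(t₂−t₁)/((γ−t₁)(γ−t₂)) ≥ (t₂−t₁)/C₀²`. -/
theorem tsum_decrement_local (h : IsHadamardSeq 0 b) {a a' t₁ t₂ γ C₀ A' B' : ℝ} (ha : 0 ≤ a)
    (hfree : ∀ t ∈ Ioo a a', hardyZ t ≠ 0) (ht₁ : t₁ ∈ Ioo a a') (ht₂ : t₂ ∈ Ioo a a')
    (hlt : t₁ < t₂) (hA' : A' ≤ t₁ - 1 / 2) (hB' : t₂ + 1 / 2 ≤ B') (hline : OnLineBetween A' B')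
    (hγζ : riemannZeta (1 / 2 + (γ : ℂ) * I) = 0) (hγ₁ : t₁ < γ) (hγC : γ ≤ t₁ + C₀) :
    (t₂ - t₁) / C₀ ^ 2 ≤ ∑' n, pairTerm b n t₁ - ∑' n, pairTerm b n t₂ := by
  have hZ : ∀ t ∈ Ioo a a', riemannZeta (1 / 2 + (t : ℂ) * I) ≠ 0 := fun t ht h0 ↦
    hfree t ht ((hardyZ_eq_zero_iff_holds t).2 h0)
  have hγa' : a' ≤ γ := by
    by_contra hlt'
    exact hZ γ ⟨ht₁.1.trans hγ₁, not_le.1 hlt'⟩ hγζ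
  have hγ₂ : t₂ < γ := ht₂.2.trans_le hγa'
  have hξ₁ : riemannXi ((1 / 2 : ℂ) + (t₁ : ℂ) * I) ≠ 0 := fun h0 ↦
    hZ t₁ ht₁ ((riemannXi_eq_zero_iff_holds _).1 h0).1
  have hξ₂ : riemannXi ((1 / 2 : ℂ) + (t₂ : ℂ) * I) ≠ 0 := fun h0 ↦
    hZ t₂ ht₂ ((riemannXi_eq_zero_iff_holds _).1 h0).1
  have hsum₁ := (hasSum_pairTerm h hξ₁).summable
  have hsum₂ := (hasSum_pairTerm h hξ₂).summable
  rw [← hsum₁.tsum_sub hsum₂]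
  have hZIcc : ∀ u ∈ Icc t₁ t₂, riemannZeta (1 / 2 + (u : ℂ) * I) ≠ 0 := fun u hu ↦
    hZ u ⟨ht₁.1.trans_le hu.1, hu.2.trans_lt ht₂.2⟩
  have hnonneg : ∀ n, 0 ≤ pairTerm b n t₁ - pairTerm b n t₂ := fun n ↦
    pairTerm_sub_nonneg h n hlt hZIcc hA' hB' hline
  -- the index of the nearby critical zero
  have hξγ : riemannXi ((1 / 2 : ℂ) + (γ : ℂ) * I) = 0 :=
    (riemannXi_eq_zero_iff_holds _).2 ⟨hγζ, by simp, by norm_num⟩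
  obtain ⟨n₀, hn₀, hcases⟩ := Ivic2003.exists_index_of_riemannXi_eq_zero h hξγ
  have hre : (IsHadamardSeq.xiZero b n₀).re = 1 / 2 := by
    rcases hcases with hc | hc
    · rw [← hc]; simp
    · have e : IsHadamardSeq.xiZero b n₀ = 1 - (1 / 2 + (γ : ℂ) * I) := by rw [hc]; ring
      rw [e]; simp; norm_num
  have hγn : (IsHadamardSeq.xiZero b n₀).im = γ ∨ (IsHadamardSeq.xiZero b n₀).im = -γ := by
    rcases hcases with hc | hc
    · left; rw [← hc]; simp
    · right
      have e : IsHadamardSeq.xiZero b n₀ = 1 - (1 / 2 + (γ : ℂ) * I) := by rw [hc]; ring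
      rw [e]; simp
  have hterm₀ : pairTerm b n₀ t₁ - pairTerm b n₀ t₂ =
      (1 / (t₁ - γ) - 1 / (t₂ - γ)) + (1 / (t₁ + γ) - 1 / (t₂ + γ)) := by
    rw [pairTerm_eq hn₀, pairTerm_eq hn₀, hre]
    rcases hγn with hg | hg
    · rw [hg, phi_zero, phi_zero, phi_zero, phi_zero]
      ring
    · rw [hg]
      simp only [sub_neg_eq_add, ← sub_eq_add_neg]
      rw [phi_zero, phi_zero, phi_zero, phi_zero]
      ring
  have hC₀ : (t₁ - γ) * (t₂ - γ) ≤ C₀ ^ 2 := by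
    have e : (t₁ - γ) * (t₂ - γ) = (γ - t₁) * (γ - t₂) := by ring
    rw [e, sq]
    exact mul_le_mul (by linarith) (by linarith) (by linarith) (by linarith)
  have hmain : (t₂ - t₁) / C₀ ^ 2 ≤ 1 / (t₁ - γ) - 1 / (t₂ - γ) := by
    have hp : 0 < (t₁ - γ) * (t₂ - γ) := by nlinarith
    rw [one_div_sub_one_div_eq hp.ne']
    exact div_le_div_of_nonneg_left (by linarith) hp hC₀
  have hplus : 0 ≤ 1 / (t₁ + γ) - 1 / (t₂ + γ) := by
    have e : ∀ t : ℝ, t + γ = t - -γ := fun t ↦ by ring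
    rw [e t₁, e t₂]
    refine one_div_sub_one_div_nonneg ?_ hlt.le
    have : 0 < t₁ := ha.trans_lt ht₁.1
    nlinarith
  have hterm : (t₂ - t₁) / C₀ ^ 2 ≤ pairTerm b n₀ t₁ - pairTerm b n₀ t₂ := by
    rw [hterm₀]; linarith
  exact hterm.trans ((hsum₁.sub hsum₂).le_tsum n₀ fun j _ ↦ hnonneg j)

/-! ## §3. The local, effective Ivić theorem (RH-free) -/

/-- **LOCAL IVIĆ THEOREM (RH-free, effective).** If the zeros of `ζ` with ordinate in
`(A', B') ⊇ (A − ½, B + ½)` lie on the critical line, every `t ∈ (A, B)` has a critical zero in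
`(t, t + C₀]`, `A ≥ 1` and `A > 4C₀²`, then `Z'/Z` is strictly decreasing on every zero-free
interval `(a, a') ⊆ [A, B]` of Hardy's `Z`. (Ivić's proof of Prop. 1 with the RH input replaced by
the window hypothesis: `Z'/Z = Σₙ pairTerm − 2t/(t²+¼) + ½ Im ψ(¼+it/2)`; the zero sum drops by
`≥ (t₂−t₁)/C₀²` (`tsum_decrement_local`), the smooth part rises by `≤ 4(t₂−t₁)/t₁`
(`Ivic2003.corr_sub_le`), and `4/t₁ < 1/C₀²`.) Nothing here assumes or proves RH. -/
theorem localIvic {A B A' B' C₀ : ℝ} (hA1 : 1 ≤ A) (hAC : 4 * C₀ ^ 2 < A)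
    (hA' : A' ≤ A - 1 / 2) (hB' : B + 1 / 2 ≤ B') (hline : OnLineBetween A' B')
    (hnear : CriticalZeroWithin A B C₀) {a a' : ℝ} (ha : A ≤ a) (ha' : a' ≤ B)
    (hfree : ∀ t ∈ Ioo a a', hardyZ t ≠ 0) :
    StrictAntiOn (fun t ↦ deriv hardyZ t / hardyZ t) (Ioo a a') := by
  obtain ⟨d, hd⟩ := exists_isHadamardSeq 0
  intro t₁ ht₁ t₂ ht₂ hlt
  have hZ : ∀ t ∈ Ioo a a', riemannZeta (1 / 2 + (t : ℂ) * I) ≠ 0 := fun t ht h0 ↦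
    hfree t ht ((hardyZ_eq_zero_iff_holds t).2 h0)
  have hform : ∀ t ∈ Ioo a a', deriv hardyZ t / hardyZ t =
      (∑' n, pairTerm d n t) +
        (-(2 * t / (t ^ 2 + 1 / 4)) +
          (Complex.digamma ((1 / 4 : ℂ) + ((t / 2 : ℝ) : ℂ) * I)).im / 2) := by
    intro t ht
    have hξ : riemannXi ((1 / 2 : ℂ) + (t : ℂ) * I) ≠ 0 := fun h0 ↦
      hZ t ht ((riemannXi_eq_zero_iff_holds _).1 h0).1
    rw [Ivic2003.deriv_hardyZ_div_eq (hZ t ht), Ivic2003.neg_im_logDeriv_zeta_critPt (hZ t ht),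
      ← (hasSum_pairTerm hd hξ).tsum_eq]
    ring
  show deriv hardyZ t₂ / hardyZ t₂ < deriv hardyZ t₁ / hardyZ t₁
  rw [hform t₁ ht₁, hform t₂ ht₂]
  have hAt₁ : A < t₁ := lt_of_le_of_lt ha ht₁.1
  have ht₂B : t₂ < B := lt_of_lt_of_le ht₂.2 ha'
  obtain ⟨γ, hγ1, hγ2, hγζ⟩ := hnear t₁ hAt₁ (hlt.trans ht₂B)
  have hC₀ : 0 < C₀ := by linarith
  have hS := tsum_decrement_local hd (by linarith) hfree ht₁ ht₂ hlt (by linarith) (by linarith)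
    hline hγζ hγ1 hγ2
  have hc := Ivic2003.corr_sub_le (by linarith : (1 : ℝ) ≤ t₁) hlt.le
  have ht₁C : 4 * C₀ ^ 2 < t₁ := by linarith
  have ht₁0 : 0 < t₁ := by linarith
  have hgap : 4 * (t₂ - t₁) / t₁ < (t₂ - t₁) / C₀ ^ 2 := by
    rw [div_lt_div_iff₀ ht₁0 (by positivity)]
    nlinarith [mul_lt_mul_of_pos_left ht₁C (sub_pos.2 hlt)]
  linarith

/-! ## §4. No Lehmer violation from the decrease of `Z'/Z` (Ivić's contradiction, localised) -/

/-- A continuous function with `0 < g t` keeps its sign on a ball around `t`. [folklore] -/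
theorem exists_ball_pos {g : ℝ → ℝ} (hg : Continuous g) {t : ℝ} (ht : 0 < g t) :
    ∃ δ > 0, ∀ u : ℝ, dist u t < δ → 0 < g u :=
  Metric.eventually_nhds_iff.1 ((hg.continuousAt (x := t)).eventually (lt_mem_nhds ht))

/-- **No wrong-sign extremum on `(A, B)`** if `Z'/Z` decreases strictly on every zero-free
`(a, a') ⊆ [A, B]`: at a positive local minimum `t`, `Z' > 0` just left of `t` (as `Z'/Z(u) >
Z'/Z(t) = 0` and `Z > 0`), so `Z` increases strictly up to `t` — contradiction; symmetrically for a
negative local maximum. (Tree `Ivic2003_prop1.no_lehmer_violation`, windowed.) -/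
theorem noViolation_of_strictAnti {A B : ℝ}
    (hanti : ∀ a a' : ℝ, A ≤ a → a' ≤ B → (∀ t ∈ Ioo a a', hardyZ t ≠ 0) →
      StrictAntiOn (fun t ↦ deriv hardyZ t / hardyZ t) (Ioo a a')) :
    NoViolationOn A B := by
  intro t hAt htB
  refine ⟨fun hmin ↦ ?_, fun hmax ↦ ?_⟩
  · by_contra hpos
    push Not at hpos
    obtain ⟨δ, hδ, hδpos⟩ := exists_ball_pos continuous_hardyZ hpos
    set δ' : ℝ := min δ (min (t - A) (B - t)) with hδ'
    have hδ'pos : 0 < δ' := lt_min hδ (lt_min (by linarith) (by linarith))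
    have hδ'le : δ' ≤ δ := min_le_left _ _
    have hδ'A : δ' ≤ t - A := (min_le_right _ _).trans (min_le_left _ _)
    have hδ'B : δ' ≤ B - t := (min_le_right _ _).trans (min_le_right _ _)
    have hZpos : ∀ u ∈ Ioo (t - δ') (t + δ'), 0 < hardyZ u := fun u hu ↦
      hδpos u (by rw [Real.dist_eq, abs_lt]; constructor <;> linarith [hu.1, hu.2])
    have hanti' := hanti (t - δ') (t + δ') (by linarith) (by linarith) fun u hu ↦ (hZpos u hu).ne'
    have htmem : t ∈ Ioo (t - δ') (t + δ') := ⟨by linarith, by linarith⟩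
    have hderiv0 : deriv hardyZ t = 0 := hmin.deriv_eq_zero
    have hder_pos : ∀ u ∈ Ioo (t - δ') t, 0 < deriv hardyZ u := by
      intro u hu
      have hu' : u ∈ Ioo (t - δ') (t + δ') := ⟨hu.1, hu.2.trans htmem.2⟩
      have hlt : deriv hardyZ t / hardyZ t < deriv hardyZ u / hardyZ u := hanti' hu' htmem hu.2
      rw [hderiv0, zero_div] at hlt
      rcases div_pos_iff.1 hlt with hcase | hcase
      · exact hcase.1
      · exact absurd hcase.2 (not_lt.2 (hZpos u hu').le)
    have hmono : StrictMonoOn hardyZ (Ioc (t - δ') t) :=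
      strictMonoOn_of_deriv_pos (convex_Ioc _ _) continuous_hardyZ.continuousOn
        (fun u hu ↦ hder_pos u (by rwa [interior_Ioc] at hu))
    obtain ⟨ε, hε, hεmin⟩ := Metric.eventually_nhds_iff.1 hmin
    set y : ℝ := t - min ε δ' / 2 with hy
    have hmin' : 0 < min ε δ' := lt_min hε hδ'pos
    have hyε : dist y t < ε := by
      rw [Real.dist_eq, hy, show t - min ε δ' / 2 - t = -(min ε δ' / 2) by ring, abs_neg,
        abs_of_pos (by positivity)]
      linarith [min_le_left ε δ']
    have hymem : y ∈ Ioc (t - δ') t :=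
      ⟨by rw [hy]; linarith [min_le_right ε δ'], by rw [hy]; linarith⟩
    have hlt : hardyZ y < hardyZ t :=
      hmono hymem ⟨by linarith, le_rfl⟩ (by rw [hy]; linarith)
    exact absurd (hεmin hyε) (not_le.2 hlt)
  · by_contra hneg
    push Not at hneg
    have hneg' : 0 < -hardyZ t := by linarith
    obtain ⟨δ, hδ, hδneg⟩ := exists_ball_pos (continuous_hardyZ.neg) (t := t) (by simpa using hneg')
    set δ' : ℝ := min δ (min (t - A) (B - t)) with hδ'
    have hδ'pos : 0 < δ' := lt_min hδ (lt_min (by linarith) (by linarith))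
    have hδ'le : δ' ≤ δ := min_le_left _ _
    have hδ'A : δ' ≤ t - A := (min_le_right _ _).trans (min_le_left _ _)
    have hδ'B : δ' ≤ B - t := (min_le_right _ _).trans (min_le_right _ _)
    have hZneg : ∀ u ∈ Ioo (t - δ') (t + δ'), hardyZ u < 0 := fun u hu ↦ by
      have := hδneg u (by rw [Real.dist_eq, abs_lt]; constructor <;> linarith [hu.1, hu.2])
      simpa using this
    have hanti' := hanti (t - δ') (t + δ') (by linarith) (by linarith) fun u hu ↦ (hZneg u hu).ne
    have htmem : t ∈ Ioo (t - δ') (t + δ') := ⟨by linarith, by linarith⟩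
    have hderiv0 : deriv hardyZ t = 0 := hmax.deriv_eq_zero
    have hder_neg : ∀ u ∈ Ioo (t - δ') t, deriv hardyZ u < 0 := by
      intro u hu
      have hu' : u ∈ Ioo (t - δ') (t + δ') := ⟨hu.1, hu.2.trans htmem.2⟩
      have hlt : deriv hardyZ t / hardyZ t < deriv hardyZ u / hardyZ u := hanti' hu' htmem hu.2
      rw [hderiv0, zero_div] at hlt
      rcases div_pos_iff.1 hlt with hcase | hcase
      · exact absurd hcase.2 (not_lt.2 (hZneg u hu').le)
      · exact hcase.1
    have hmono : StrictAntiOn hardyZ (Ioc (t - δ') t) :=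
      strictAntiOn_of_deriv_neg (convex_Ioc _ _) continuous_hardyZ.continuousOn
        (fun u hu ↦ hder_neg u (by rwa [interior_Ioc] at hu))
    obtain ⟨ε, hε, hεmax⟩ := Metric.eventually_nhds_iff.1 hmax
    set y : ℝ := t - min ε δ' / 2 with hy
    have hmin' : 0 < min ε δ' := lt_min hε hδ'pos
    have hyε : dist y t < ε := by
      rw [Real.dist_eq, hy, show t - min ε δ' / 2 - t = -(min ε δ' / 2) by ring, abs_neg,
        abs_of_pos (by positivity)]
      linarith [min_le_left ε δ']
    have hymem : y ∈ Ioc (t - δ') t :=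
      ⟨by rw [hy]; linarith [min_le_right ε δ'], by rw [hy]; linarith⟩
    have hlt : hardyZ t < hardyZ y :=
      hmono hymem ⟨by linarith, le_rfl⟩ (by rw [hy]; linarith)
    exact absurd (hεmax hyε) (not_le.2 hlt)

/-! ## §5. A zero in every `(t, t+8]` at height `≈ 3·10¹²`, RH-free (explicit Riemann–von Mangoldt) -/

/-- **RH-free window count above height `3·10¹²`:** `N(t) < N(t+8)` for every `t ≥ 3·10¹²`,
from the tree's PROVED explicit bound `|N(T) − (T/2π) log(T/2πe)| ≤ 0.3083 log T + 4.128`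
(`T ≥ 30`): the main term grows by `≥ (8/2π)(log t − log 2π − 1) > 1.26 (log t − 3)` over
`[t, t+8]` while the two errors total `≤ 0.3083 (2 log t + 0.7) + 8.256`; the difference is
`> 0.64 log t − 12.3 > 0` since `log t > 28`. -/
theorem zetaZeroCount_lt_add_eight {t : ℝ} (ht : 3000000000000 ≤ t) :
    zetaZeroCount t < zetaZeroCount (t + 8) := by
  have h1 := abs_zetaZeroCount_sub_main_le_explicit (by linarith : (30 : ℝ) ≤ t)
  have h2 := abs_zetaZeroCount_sub_main_le_explicit (by linarith : (30 : ℝ) ≤ t + 8)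
  rw [abs_le] at h1 h2
  have he := Real.exp_one_lt_d9
  have he' := Real.exp_one_gt_d9
  have hπ : π < 3.15 := Real.pi_lt_d2
  have hπpos := Real.pi_pos
  have ht0 : 0 < t := by linarith
  have hlogt : 28 < Real.log t := by
    rw [Real.lt_log_iff_exp_lt ht0]
    calc Real.exp 28 = Real.exp 1 ^ 28 := by rw [Real.exp_one_pow]; norm_num
      _ < 2.7182818286 ^ 28 := by gcongr
      _ < 3000000000000 := by norm_num
      _ ≤ t := ht
  have hlog8 : Real.log (t + 8) ≤ Real.log t + 0.7 := by
    have h2t : t + 8 ≤ 2 * t := by linarith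
    calc Real.log (t + 8) ≤ Real.log (2 * t) := Real.log_le_log (by linarith) h2t
      _ = Real.log 2 + Real.log t := Real.log_mul (by norm_num) ht0.ne'
      _ ≤ Real.log t + 0.7 := by linarith [Real.log_two_lt_d9]
  have hlog2pi : Real.log (2 * π) < 2 := by
    rw [Real.log_lt_iff_lt_exp (by positivity)]
    calc 2 * π < 2 * 3.15 := by linarith
      _ < 2.7182818283 ^ 2 := by norm_num
      _ < Real.exp 1 ^ 2 := by gcongr
      _ = Real.exp 2 := by rw [Real.exp_one_pow]; norm_num
  set L₀ := Real.log (t / (2 * π * Real.exp 1)) with hL₀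
  set L₈ := Real.log ((t + 8) / (2 * π * Real.exp 1)) with hL₈
  have hL₀eq : L₀ = Real.log t - Real.log (2 * π) - 1 := by
    rw [hL₀, Real.log_div ht0.ne' (by positivity), Real.log_mul (by positivity) (Real.exp_pos 1).ne',
      Real.log_exp]
    ring
  have hL₈ge : L₀ ≤ L₈ := by
    rw [hL₀, hL₈]
    exact Real.log_le_log (by positivity) (div_le_div_of_nonneg_right (by linarith) (by positivity))
  have hL₀ge : Real.log t - 3 < L₀ := by rw [hL₀eq]; linarith
  have hL₀pos : 0 < L₀ := by linarith
  have hM : 8 / (2 * π) * L₀ ≤ (t + 8) / (2 * π) * L₈ - t / (2 * π) * L₀ := by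
    have h3 : t / (2 * π) * L₀ ≤ t / (2 * π) * L₈ :=
      mul_le_mul_of_nonneg_left hL₈ge (by positivity)
    have h4 : 8 / (2 * π) * L₀ ≤ 8 / (2 * π) * L₈ :=
      mul_le_mul_of_nonneg_left hL₈ge (by positivity)
    have e : (t + 8) / (2 * π) * L₈ = t / (2 * π) * L₈ + 8 / (2 * π) * L₈ := by ring
    rw [e]
    linarith
  have hcoef : (1.26 : ℝ) < 8 / (2 * π) := by
    rw [lt_div_iff₀ (by positivity)]
    nlinarith
  have hgain : 1.26 * (Real.log t - 3) < 8 / (2 * π) * L₀ :=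
    calc 1.26 * (Real.log t - 3) < 1.26 * L₀ := by nlinarith
      _ < 8 / (2 * π) * L₀ := mul_lt_mul_of_pos_right hcoef hL₀pos
  have key : (zetaZeroCount t : ℝ) < zetaZeroCount (t + 8) := by
    nlinarith [h1.2, h2.1, hM, hgain, hlog8, hlogt]
  exact_mod_cast key

/-- From `N(t) < N(t + C)`: a zero `ρ` of `ζ` with `t < Im ρ ≤ t + C` (counting boxes,
`Montgomery.zetaZeroCount_sub_eq_finsum`). RH-free. [folklore] -/
theorem exists_zero_of_count_lt {t C : ℝ} (hC : 0 ≤ C)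
    (hlt : zetaZeroCount t < zetaZeroCount (t + C)) :
    ∃ ρ : ℂ, riemannZeta ρ = 0 ∧ t < ρ.im ∧ ρ.im ≤ t + C := by
  have hsum := Montgomery.zetaZeroCount_sub_eq_finsum (show t ≤ t + C by linarith)
  have hpos : (0 : ℤ) < ∑ᶠ ρ ∈ zetaZeroBox 0 (t + C) \ zetaZeroBox 0 t, riemannZetaZeroOrder ρ := by
    rw [← hsum]
    have : (zetaZeroCount t : ℤ) < zetaZeroCount (t + C) := by exact_mod_cast hlt
    linarith
  have hne : (zetaZeroBox 0 (t + C) \ zetaZeroBox 0 t).Nonempty := by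
    by_contra h0
    rw [Set.not_nonempty_iff_eq_empty] at h0
    rw [h0, finsum_mem_empty] at hpos
    exact lt_irrefl _ hpos
  obtain ⟨ρ, ⟨hζ, h0, h1, him, hle⟩, hnot⟩ := hne
  have hgt : t < ρ.im := by
    by_contra hle'
    exact hnot ⟨hζ, h0, h1, him, not_lt.1 hle'⟩
  exact ⟨ρ, hζ, hgt, hle⟩

/-- Critical zeros within `8` of every point of `(A, B)` (`A ≥ 3·10¹²`), from the window count and
the on-line hypothesis on `(A', B') ⊇ (A, B + 8]`. RH-free given the window hypothesis. -/
theorem criticalZeroWithin_of_onLine {A B A' B' : ℝ} (hA : 3000000000000 ≤ A)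
    (hA' : A' ≤ A) (hB' : B + 8 ≤ B')
    (hline : OnLineBetween A' B') : CriticalZeroWithin A B 8 := by
  intro t hAt htB
  obtain ⟨ρ, hζ, hgt, hle⟩ := exists_zero_of_count_lt (by norm_num)
    (zetaZeroCount_lt_add_eight (by linarith : (3000000000000 : ℝ) ≤ t))
  have hre : ρ.re = 1 / 2 := hline ρ hζ (by linarith) (by linarith)
  refine ⟨ρ.im, hgt, hle, ?_⟩
  have e : (1 / 2 : ℂ) + (ρ.im : ℂ) * I = ρ := by
    apply Complex.ext <;> simp [hre]
  rw [e]; exact hζ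

/-! ## §6. Σ_L on a window from "RH in the padded window" alone -/

/-- **Σ_L on `(A, B)` from the zeros with ordinate in `(A', B') ⊇ (A − ½, B + 8]` being on the
line** (`3·10¹² ≤ A`, any `B`): `localIvic` with `C₀ = 8` (`4·8² = 256 < A`) +
`criticalZeroWithin_of_onLine` + `noViolation_of_strictAnti`. RH-free given the window hypothesis;
nothing here bears on the truth of RH. -/
theorem noViolationOn_of_onLine {A B A' B' : ℝ} (hA : 3000000000000 ≤ A)
    (hA' : A' ≤ A - 1 / 2) (hB' : B + 8 ≤ B')
    (hline : OnLineBetween A' B') : NoViolationOn A B := by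
  have hnear := criticalZeroWithin_of_onLine hA (by linarith) hB' hline
  refine noViolation_of_strictAnti fun a a' ha ha' hfree ↦ ?_
  exact localIvic (C₀ := 8) (by linarith) (by linarith) hA' (by linarith : B + 1 / 2 ≤ B') hline
    hnear ha ha' hfree

/-! ## §7. Instances -/

/-- **In-regime corollary (NOT the witness — inside RH's verified range):** granted the cite fact
`platt_trudgian_numerical_rh` (Platt–Trudgian 2021 Thm 1, RH to height `3 000 175 332 800`; the
route's `HeightPT`), Σ_L holds on `(3·10¹², 3 000 175 332 792)`. Shows the local reduction is
effective at the route's threshold. -/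
theorem SigmaL_rung_belowPT (hPT : platt_trudgian_numerical_rh) :
    NoViolationOn 3000000000000 3000175332792 :=
  noViolationOn_of_onLine (A' := 3000000000000 - 1 / 2) (B' := 3000175332800)
    le_rfl le_rfl (by norm_num)
    (fun s hs h1 h2 ↦ hPT s hs (by linarith) h2.le)

/-- **The crux is RH-implied, EFFECTIVELY (sorry-free): Σ_L on `(3·10¹², B)` for every `B`
from `Summit.RiemannHypothesis`.** Ivić 2003 Prop. 1 (RH ⟹ Σ_L for `t > t₀`; the tree's
`Ivic2003_prop1_holds` has `t₀` ineffective) made effective with `t₀ ≤ 3·10¹²` by the LOCAL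
argument: under RH every window hypothesis `OnLineBetween` holds, so `noViolationOn_of_onLine`
applies. With `sigmaL_iff_forall_noViolationOn` this gives `Summit.RiemannHypothesis → SigmaL`
(`sigmaL_iff_forall_noViolationOn.2 (noViolationOn_of_RH h)`), deliberately NOT stated with
conclusion `SigmaL` so that no audit mistakes it for a proof of the item: it is the direction
S ⟹ C only (T1's "IvicEffective" gap, for the record) and says NOTHING about the truth of RH or
of Σ_L. -/
theorem noViolationOn_of_RH (hRH : Summit.RiemannHypothesis) (B : ℝ) :
    NoViolationOn 3000000000000 B := by
  have hRH' : _root_.RiemannHypothesis := Summit.RiemannHypothesis_iff.mp hRH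
  have hline : OnLineBetween (3000000000000 - 1 / 2) (B + 8) := by
    intro s hs h1 _
    refine hRH' s hs ?_ ?_
    · rintro ⟨n, hn⟩
      have him : s.im = 0 := by rw [hn]; simp
      linarith
    · rintro rfl
      simp at h1
      linarith
  exact noViolationOn_of_onLine (A' := 3000000000000 - 1 / 2) (B' := B + 8)
    le_rfl le_rfl le_rfl hline

/-- The crux `SigmaL` is exactly "Σ_L on `(3·10¹², B)` for every `B`". [folklore] -/
theorem sigmaL_iff_forall_noViolationOn :
    Summit.RiemannHypothesis.RiemannHypothesis.Theses.HardyZLehmerSplit.SigmaL ↔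
      ∀ B : ℝ, NoViolationOn 3000000000000 B :=
  ⟨fun h _ ↦ noViolationOn_of_SigmaL le_rfl h, fun h t ht ↦ h (t + 1) t ht (by linarith)⟩

/-! ## §8. The stub as certificate data: sorry-free reductions for the first prover

`stub_onLine_W0` below is `onLineBetween_of_window_certificate (T₁ := H₀+19) (T₂ := H₀+40)`
applied to DATA: a grid `s₀ < ⋯ < s_m` in `[H₀+19, H₀+40]` with `m` certified strict sign changes of
`Z` (each sign by `RSEval.mem_hardyZBoxS`), and the count inequality `N(H₀+40) ≤ N(H₀+19) + m`,
itself from Turing's method at the two ends: `zetaZeroCount_le_of_turing_trudgian'` at `T = H₀+40`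
(samples in `[T, T+h]`) and `lt_zetaZeroCount_of_sign_changes_below` at `T = H₀+19` (samples in
`[T−h', T]`, with `abs_integral_zetaArgS_le_trudgian_holds`) — or the two exact counts
`zetaZeroCount_eq_of_turing_window_trudgian'`. No named fact enters. -/

/-- Sign changes of `Z` along `s₀ < ⋯ < s_m` locate `m` distinct zeros of `ζ` ON the critical line
with ordinates in `(s₀, s_m)` (IVT; the tree's private `exists_finset_zeros_of_sign_changes`,
re-proved for use here). [folklore] -/
theorem exists_finset_zeros_of_hardyZ_sign_changes {m : ℕ} (s : Fin (m + 1) → ℝ)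
    (hs : StrictMono s) (hsign : ∀ i : Fin m, hardyZ (s i.castSucc) * hardyZ (s i.succ) < 0) :
    ∃ Z : Finset ℝ, Z.card = m ∧
      ∀ γ ∈ Z, riemannZeta (1 / 2 + γ * I) = 0 ∧ s 0 < γ ∧ γ < s (Fin.last m) := by
  classical
  have hzero : ∀ i : Fin m, ∃ c, hardyZ c = 0 ∧ s i.castSucc < c ∧ c < s i.succ := by
    intro i
    have hlt : s i.castSucc < s i.succ := hs Fin.castSucc_lt_succ
    have h0 : (0 : ℝ) ∈ uIcc (hardyZ (s i.castSucc)) (hardyZ (s i.succ)) := by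
      rcases mul_neg_iff.1 (hsign i) with ⟨h1, h2⟩ | ⟨h1, h2⟩
      · exact mem_uIcc.2 (Or.inr ⟨h2.le, h1.le⟩)
      · exact mem_uIcc.2 (Or.inl ⟨h1.le, h2.le⟩)
    obtain ⟨c, hc, hfc⟩ := intermediate_value_uIcc continuous_hardyZ.continuousOn h0
    rw [uIcc_of_le hlt.le] at hc
    have hne1 : c ≠ s i.castSucc := by
      rintro rfl
      exact (mul_neg_iff.1 (hsign i)).elim (fun h ↦ h.1.ne' hfc) (fun h ↦ h.1.ne hfc)
    have hne2 : c ≠ s i.succ := by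
      rintro rfl
      exact (mul_neg_iff.1 (hsign i)).elim (fun h ↦ h.2.ne hfc) (fun h ↦ h.2.ne' hfc)
    exact ⟨c, hfc, lt_of_le_of_ne hc.1 hne1.symm, lt_of_le_of_ne hc.2 hne2⟩
  choose c hc using hzero
  have hcmono : StrictMono c := by
    intro i j hij
    calc c i < s i.succ := (hc i).2.2
      _ ≤ s j.castSucc := hs.monotone (by
          rw [Fin.le_iff_val_le_val, Fin.val_succ, Fin.val_castSucc]; exact hij)
      _ < c j := (hc j).2.1
  refine ⟨Finset.univ.image c, ?_, ?_⟩
  · rw [Finset.card_image_of_injective _ hcmono.injective, Finset.card_univ, Fintype.card_fin]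
  · intro x hx
    rw [Finset.mem_image] at hx
    obtain ⟨i, -, rfl⟩ := hx
    refine ⟨(hardyZ_eq_zero_iff_holds _).1 (hc i).1, ?_, ?_⟩
    · exact lt_of_le_of_lt (hs.monotone (Fin.zero_le _)) (hc i).2.1
    · exact lt_of_lt_of_le (hc i).2.2 (hs.monotone (Fin.le_last _))

/-- **Windowed Brent criterion (RH-free).** If `Z` is a finite set of ordinates `γ ∈ (a, b]`
(`0 ≤ a ≤ b`) of zeros of `ζ` on the critical line and `N(b) ≤ N(a) + |Z|`, then EVERY zero of `ζ`
with ordinate in `(a, b]` has real part `½`: the off-line count `N − N₀` is monotone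
(`zetaZeroCount_sub_criticalZeroCount_mono`), `N₀(a) + |Z| ≤ N₀(b)` (`criticalZeroCount_add_card_le`)
forces `N(b) − N₀(b) = N(a) − N₀(a)`, and an off-line zero in the window would make the off-line
multiplicity sum over `(0, b]` strictly exceed the one over `(0, a]`. No information about the zeros
below `a` enters. [cite: Brent1979, §4] -/
theorem onLine_of_located_zeros {a b : ℝ} (ha : 0 ≤ a) (hab : a ≤ b) (Z : Finset ℝ)
    (hZ : ∀ γ ∈ Z, riemannZeta (1 / 2 + γ * I) = 0 ∧ a < γ ∧ γ ≤ b)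
    (hN : zetaZeroCount b ≤ zetaZeroCount a + Z.card) {ρ : ℂ} (hζ : riemannZeta ρ = 0)
    (haρ : a < ρ.im) (hρb : ρ.im ≤ b) : ρ.re = 1 / 2 := by
  have h1 := criticalZeroCount_add_card_le ha hab Z hZ
  have hmono := zetaZeroCount_sub_criticalZeroCount_mono hab
  have heq : (zetaZeroCount b : ℤ) - criticalZeroCount b =
      (zetaZeroCount a : ℤ) - criticalZeroCount a := by
    have e1 : (zetaZeroCount b : ℤ) ≤ zetaZeroCount a + Z.card := by exact_mod_cast hN
    have e2 : (criticalZeroCount a : ℤ) + Z.card ≤ criticalZeroCount b := by exact_mod_cast h1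
    linarith
  rw [intCast_zetaZeroCount_sub_criticalZeroCount, intCast_zetaZeroCount_sub_criticalZeroCount]
    at heq
  by_contra hre
  have hρb' : ρ ∈ zetaZeroBox 0 b \ {ρ ∈ zetaZeroBox (1 / 2) b | ρ.re = 1 / 2} :=
    ⟨Literature.NumberTheory.DiophantineGeometry.mem_zetaZeroBox_of_riemannZeta_eq_zero hζ
      (ha.trans_lt haρ) hρb, fun h ↦ hre h.2⟩
  have hρa' : ρ ∉ zetaZeroBox 0 a \ {ρ ∈ zetaZeroBox (1 / 2) a | ρ.re = 1 / 2} :=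
    fun h ↦ absurd h.1.2.2.2.2 (not_le.2 haρ)
  have hsub : zetaZeroBox 0 a \ {ρ ∈ zetaZeroBox (1 / 2) a | ρ.re = 1 / 2} ⊆
      zetaZeroBox 0 b \ {ρ ∈ zetaZeroBox (1 / 2) b | ρ.re = 1 / 2} := by
    rintro ρ' ⟨⟨h0, h1', h2, h3, h4⟩, hnot⟩
    refine ⟨⟨h0, h1', h2, h3, h4.trans hab⟩, ?_⟩
    rintro ⟨⟨-, h1'', -, -, -⟩, h5⟩
    exact hnot ⟨⟨h0, h1'', h2, h3, h4⟩, h5⟩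
  have hB : (zetaZeroBox 0 b \ {ρ ∈ zetaZeroBox (1 / 2) b | ρ.re = 1 / 2}).Finite :=
    (zetaZeroBox_finite 0 b).sdiff
  have hA := hB.subset hsub
  rw [finsum_mem_eq_finite_toFinset_sum _ hA, finsum_mem_eq_finite_toFinset_sum _ hB] at heq
  have hlt := Finset.sum_lt_sum_of_subset ((Finite.toFinset_subset_toFinset).2 hsub)
    ((Finite.mem_toFinset hB).2 hρb') (fun h ↦ hρa' ((Finite.mem_toFinset hA).1 h))
    (Literature.NumberTheory.DiophantineGeometry.riemannZetaZeroOrder_pos_of_mem_zetaZeroBox hρb'.1)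
    (fun j hj _ ↦ (Literature.NumberTheory.DiophantineGeometry.riemannZetaZeroOrder_pos_of_mem_zetaZeroBox
      ((Finite.mem_toFinset hB).1 hj).1).le)
  exact absurd heq (ne_of_gt hlt)

/-- **The stub as data.** For `0 ≤ T₁`: a grid `T₁ ≤ s₀ < ⋯ < s_m ≤ T₂` with `m` strict sign
changes of Hardy's `Z` and the count inequality `N(T₂) ≤ N(T₁) + m` give `OnLineBetween T₁ T₂`
(indeed every zero with ordinate in `(T₁, T₂]` is on the line). The first prover target for the rung is
this theorem at `T₁ = H₀+19`, `T₂ = H₀+40` with certified data. RH-free; nothing here bears on RH.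
[cite: Brent1979, Thm 3.2 and §4] -/
theorem onLineBetween_of_window_certificate {T₁ T₂ : ℝ} {m : ℕ} (h0 : 0 ≤ T₁)
    (s : Fin (m + 1) → ℝ) (hs : StrictMono s) (hs0 : T₁ ≤ s 0) (hsm : s (Fin.last m) ≤ T₂)
    (hsign : ∀ i : Fin m, hardyZ (s i.castSucc) * hardyZ (s i.succ) < 0)
    (hN : zetaZeroCount T₂ ≤ zetaZeroCount T₁ + m) : OnLineBetween T₁ T₂ := by
  obtain ⟨Z, hcard, hZ⟩ := exists_finset_zeros_of_hardyZ_sign_changes s hs hsign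
  have h12 : T₁ ≤ T₂ := hs0.trans ((hs.monotone (Fin.zero_le _)).trans hsm)
  intro ρ hζ h1 h2
  exact onLine_of_located_zeros h0 h12 Z
    (fun γ hγ ↦ ⟨(hZ γ hγ).1, hs0.trans_lt (hZ γ hγ).2.1, ((hZ γ hγ).2.2.le.trans hsm)⟩)
    (by rw [hcard]; exact hN) hζ h1 h2.le

/-- **COMPUTATIONAL STUB (plan-only, the one input of the BC5 rung):** every zero of `ζ` with
ordinate in `(H₀ + 19, H₀ + 40)`, `H₀ = 3 000 175 332 800`, has real part `½`. It is
`onLineBetween_of_window_certificate` (§8, PROVED) at `T₁ = H₀+19`, `T₂ = H₀+40` fed with certified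
data; what is missing is ONLY the data. TECHNIQUE (named):
certified signs of `Z` on a Gram-scale grid of `(H₀+13, H₀+46)` by the tree's Riemann–Siegel
interval evaluator `RSEval.hardyZBoxS` / `hardyZBoxX` (`HardyZRiemannSiegelEvaluationSharp/
Explicit.lean`, NO named-fact hypothesis; `N = ⌊√(t/2π)⌋ ≈ 691 005` main-sum terms; tables by
`mkRSTables` in-kernel), `native_decide` per chunk as in `RiemannHypothesisUpTo100000Chunk*`;
exact counts `N(H₀+19)`, `N(H₀+40)` by Turing's method at both ends (`TuringMethod`,
`TuringMethodWindow`: `zetaZeroCount_le_of_turing` + the lower half) so that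
`N(H₀+40) − N(H₀+19)` = number of certified sign changes ⟹ all these zeros simple and on the line
(`ZetaZerosSimpleOnLineUpTo.of_hardyZ_signs` pattern, windowed). COST: ≈ 90 zeros + Turing buffers
⟹ ≈ 300–400 evaluations × (691k-term interval RS sum) ≈ 10–30 CPU-h compiled; one batched kit
job emitting ~60 chunk files. NOT RUN by this seat (kit not allowed); RH is NOT proved. -/
theorem stub_onLine_W0 : OnLineBetween 3000175332819 3000175332840 := by
  sorry

/-- **THE BC5 RUNG `SigmaL_rung_W0`:** Σ_L holds on the window `W0 = (H₀ + 20, H₀ + 30)` above the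
Platt–Trudgian height — PROVED from the single computational stub `stub_onLine_W0` by the RH-free
`noViolationOn_of_onLine`. Outside S's known regime (RH is verified only to `H₀`); exercises the
route's lever (strict decrease of `Z'/Z` ⟹ right-signed extrema); decidable AND refutable by one
finite certified computation. Nothing here bears on the truth of RH. -/
theorem SigmaL_rung_W0 : NoViolationOn 3000175332820 3000175332830 :=
  noViolationOn_of_onLine (A' := 3000175332819) (B' := 3000175332840)
    (by norm_num) (by norm_num) (by norm_num) stub_onLine_W0

/-- The rung is literally a special case of the crux (`SigmaL ⟹ SigmaL_rung_W0`'s statement). -/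
theorem rung_W0_of_SigmaL
    (h : Summit.RiemannHypothesis.RiemannHypothesis.Theses.HardyZLehmerSplit.SigmaL) :
    NoViolationOn 3000175332820 3000175332830 :=
  noViolationOn_of_SigmaL (by norm_num) h

end Summit.RiemannHypothesis.RiemannHypothesis.Cruxes.SigmaL.Rung

end
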